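import Mathlib
import HarnessLib
import Summits.NavierStokesRegularity.NavierStokesRegularity.Theses.LocalPressureProfileDoor
import Summits.NavierStokesRegularity.NavierStokesRegularity.Theorems.LocalSineTubeDoorLocalPointZoomGradSlices
import Summits.NavierStokesRegularity.NavierStokesRegularity.Theorems.LocalPressureProfileDoorZoomFramePressure

/-!
# Route `LocalPressureProfileDoor` (nsreg-p1 ROUND-16, door S17⁺) — crux K1 `LocalPointZoomSimilarityPressure`
# (stmt-NavierStokesRegularity-20181): PROVED

Seat `ns-pressure-K1-p1` (`--workitem stmt-NavierStokesRegularity-20181`).  The crux: at a point `(x₀, T)` where a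
classical Leray–Hopf flow from rapidly decaying data is locally SPACE–TIME Type I
(`‖u(t,x)‖(‖x − x₀‖ + √(ν(T − t))) ≤ M` on a backward parabolic cylinder) but not backward bounded, some zoom sequence
`λⱼ → 0⁺` of unit-viscosity rescalings converges to a door-class profile `v` (Type I in time, space–time decay,
continuous, Oseen-mild, divergence-free) with backward-singular apex, and for every `t < 0`, `y` the similarity Riesz
pressure converges: `ν⁻¹(T − tⱼ) Q[u(tⱼ)](x₀ + √(T − tⱼ)√ν y) → (−t) Q[v(t)](√(−t) y)`, `tⱼ = T + λⱼ²t/ν`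
(`Q = pressurePotential`, the gauge-free Riesz pressure `RᵢRⱼ(uᵢuⱼ)`).

* `frame_rescale` — the `σ`-rescaled zoom frame (scales `σλⱼ`, limit and profile `σ • (· ∘ (σ², σ))`), the bookkeeping
  block of `localPointZoomVelGradSlices` / `…HessSlices` as a lemma;
* `localPointZoomPressureSlices` — the tree zoom (frame `localTreeZoomFrame`; velocity upgrade `localZoomFrame_tendsto`)
  with, at EVERY `s < 0`, `y`, convergence of the rescaled velocities AND of the Riesz pressures of the rescaled slices,
  `Q[(λⱼ/ν) u(tⱼ, x₀ + λⱼ ·)](y) → Q[v(s)](y)` — the frame-level `localZoomFrame_pressure_tendsto` at time `−1` of the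
  `√(−s)`-rescaled frame, moved back by the dilation covariance of `Q` (`pressurePotential_zoom_of_integrable` for the
  finite-energy slices, `pressurePotential_zoom` for the profile); the space–time decay `HasTypeIDecay (M/ν) v` is
  `hasTypeIDecay_of_zoom`;
* `LocalPointZoomSimilarityPressure_proof` — the crux by name: affine covariance
  `Q[(λ/ν) u(t, x₀ + λ ·)](z) = (λ/ν)² Q[u(t)](x₀ + λ z)` (`pressurePotential_smul_comp_affine`) and the bookkeeping
  `ν⁻¹(T − tⱼ) = (−t)(λⱼ/ν)²`, `√(T − tⱼ)√ν = λⱼ√(−t)`.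

The registered birth line (Cruxes/LocalPointZoomSimilarityPressure/Lines/birth.lean) split the crux as
`stub_zoomWithSpaceTimeDecay` (landed, p514542) → `stub_similarityPressureAlongZoom`; the second stub quantified over an
ARBITRARY pointwise-convergent zoom, which would need the Seregin–Šverák regularity machine re-run outside the frame; the
lead reshaped the line to prove the pressure clause INSIDE the frame (helpers `…PressureCovariance`, `…PressureSliceLimit`,
`…ZoomFramePressure`) and closes the crux directly here.

WHAT THIS IS NOT: not a claim about Navier–Stokes regularity (Clay A); K1 of a CONDITIONAL door (bears_on LADDER-NS N0,
rung N0-LocalTubeDoorPressureProfile), whose content is the open K2⁺ `MonotonePressureProfileRigidity`.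
-/

noncomputable section

-- the summit and its single sub-problem share the name (CONVENTIONS §1), as in every Theorems file
set_option linter.dupNamespace false

namespace Summit.NavierStokesRegularity.NavierStokesRegularity.Theorems.LocalPressureProfileDoorLocalPointZoomSimilarityPressure

open MeasureTheory Set Function Filter Topology TopologicalSpace Metric
open Literature.Analysis Literature.Analysis.FluidPDE Literature.Analysis.FluidPDE.SereginSverak2009
open Summit.NavierStokesRegularity.NavierStokesRegularity.Theorems
open Summit.NavierStokesRegularity.NavierStokesRegularity.Theorems.LocalSineTubeDoorProfileAlignedWindowRigidityAncient
open Summit.NavierStokesRegularity.NavierStokesRegularity.Theorems.LocalSineTubeDoorLocalPointZoomFrame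
open Summit.NavierStokesRegularity.NavierStokesRegularity.Theorems.LocalSineTubeDoorLocalPointZoomSlices
open Summit.NavierStokesRegularity.NavierStokesRegularity.Theorems.LocalVelCompTubeDoorLocalPointZoomVel
open Summit.NavierStokesRegularity.NavierStokesRegularity.Theorems.PlaneStrainDoorZoomSpaceTimeDecay
open Summit.NavierStokesRegularity.NavierStokesRegularity.Theorems.SymmetricScarExists.LogtimeBernoulli
  (pressurePotential_zoom)
open Summit.NavierStokesRegularity.NavierStokesRegularity.Theorems.LocalPressureProfileDoorPressureCovariance
open Summit.NavierStokesRegularity.NavierStokesRegularity.Theorems.LocalPressureProfileDoorZoomFramePressure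
open scoped NNReal ENNReal

/-- **The `σ`-rescaled zoom frame** (bookkeeping block of `localPointZoomVelGradSlices`): rescaling the zooms, their
`L³_loc` limit and the profile by the Navier–Stokes scaling `σ • (· ∘ (σ²·, σ·))` about the apex gives again frame data —
scales `σλⱼ → 0⁺`, the identification with the zooms of `u` at the scales `Rσλⱼ/2`, local `L³` convergence, and the a.e.
identification of the rescaled limit with the rescaled profile. -/
theorem frame_rescale {ν T : ℝ} {u : ℝ → EuclideanSpace ℝ (Fin 3) → EuclideanSpace ℝ (Fin 3)}
    {x₀ : EuclideanSpace ℝ (Fin 3)} {R : ℝ} {v' : ℝ → EuclideanSpace ℝ (Fin 3) → EuclideanSpace ℝ (Fin 3)}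
    {lam : ℕ → ℝ} (hlam : ∀ j, 0 < lam j) (hlam0 : Tendsto lam atTop (𝓝 0))
    (hpt : ∀ (j : ℕ) (s : ℝ) (y : EuclideanSpace ℝ (Fin 3)),
      ((lam j) • stPull ((lam j) ^ 2) (lam j) (0 : ℝ) (0 : EuclideanSpace ℝ (Fin 3)) v') s y =
        ((R * (lam j / 2)) / ν) • u (T + (R * (lam j / 2)) ^ 2 * s / ν) (x₀ + (R * (lam j / 2)) • y))
    {w v₁ : ℝ → EuclideanSpace ℝ (Fin 3) → EuclideanSpace ℝ (Fin 3)}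
    (hL3 : ∀ a : ℝ, 0 < a → Tendsto (fun j => eLpNorm
      (uncurry ((lam j) • stPull ((lam j) ^ 2) (lam j) (0 : ℝ) (0 : EuclideanSpace ℝ (Fin 3)) v') - uncurry w) 3
      (volume.restrict (parabolicCylinder a (0 : ℝ × EuclideanSpace ℝ (Fin 3))))) atTop (𝓝 0))
    (hae : ∀ᵐ x ∂(volume.restrict (Iio (0 : ℝ) ×ˢ (univ : Set (EuclideanSpace ℝ (Fin 3))))),
      uncurry w x = uncurry v₁ x)
    {σ : ℝ} (hσ : 0 < σ) :
    (∀ j, 0 < σ * lam j) ∧ Tendsto (fun j => σ * lam j) atTop (𝓝 0) ∧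
    (∀ (j : ℕ) (s' : ℝ) (y' : EuclideanSpace ℝ (Fin 3)),
      ((σ * lam j) • stPull ((σ * lam j) ^ 2) (σ * lam j) (0 : ℝ) (0 : EuclideanSpace ℝ (Fin 3)) v') s' y' =
        ((R * (σ * lam j / 2)) / ν) • u (T + (R * (σ * lam j / 2)) ^ 2 * s' / ν) (x₀ + (R * (σ * lam j / 2)) • y')) ∧
    (∀ a : ℝ, 0 < a → Tendsto (fun j => eLpNorm
      (uncurry ((σ * lam j) • stPull ((σ * lam j) ^ 2) (σ * lam j) (0 : ℝ) (0 : EuclideanSpace ℝ (Fin 3)) v') -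
        uncurry (σ • stPull (σ ^ 2) σ (0 : ℝ) (0 : EuclideanSpace ℝ (Fin 3)) w)) 3
      (volume.restrict (parabolicCylinder a (0 : ℝ × EuclideanSpace ℝ (Fin 3))))) atTop (𝓝 0)) ∧
    (∀ᵐ x ∂(volume.restrict (Iio (0 : ℝ) ×ˢ (univ : Set (EuclideanSpace ℝ (Fin 3))))),
      uncurry (σ • stPull (σ ^ 2) σ (0 : ℝ) (0 : EuclideanSpace ℝ (Fin 3)) w) x =
        uncurry (σ • stPull (σ ^ 2) σ (0 : ℝ) (0 : EuclideanSpace ℝ (Fin 3)) v₁) x) := by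
  have hσne : σ ≠ 0 := hσ.ne'
  set lam' : ℕ → ℝ := fun j => σ * lam j with hlam'def
  set w' : ℝ → (EuclideanSpace ℝ (Fin 3)) → (EuclideanSpace ℝ (Fin 3)) :=
    σ • stPull (σ ^ 2) σ (0 : ℝ) (0 : (EuclideanSpace ℝ (Fin 3))) w with hw'def
  set v₁' : ℝ → (EuclideanSpace ℝ (Fin 3)) → (EuclideanSpace ℝ (Fin 3)) :=
    σ • stPull (σ ^ 2) σ (0 : ℝ) (0 : (EuclideanSpace ℝ (Fin 3))) v₁ with hv₁'def
  have hZZ : ∀ j, (lam' j) • stPull ((lam' j) ^ 2) (lam' j) (0 : ℝ) (0 : (EuclideanSpace ℝ (Fin 3))) v' =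
      σ • stPull (σ ^ 2) σ (0 : ℝ) (0 : (EuclideanSpace ℝ (Fin 3)))
        ((lam j) • stPull ((lam j) ^ 2) (lam j) (0 : ℝ) (0 : (EuclideanSpace ℝ (Fin 3))) v') := by
    intro j
    simp only [hlam'def]
    rw [zoom_zoom]
  refine ⟨fun j => mul_pos hσ (hlam j), by simpa using hlam0.const_mul σ, ?_, ?_, ?_⟩
  · -- (pt') identification with the zooms of `u` at the scales `R σλⱼ/2`
    intro j s' y'
    have h := hpt j (σ ^ 2 * s') (σ • y')
    show ((lam' j) • stPull ((lam' j) ^ 2) (lam' j) (0 : ℝ) (0 : (EuclideanSpace ℝ (Fin 3))) v') s' y' = _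
    simp only [smul_stPull_apply, zero_add] at h ⊢
    simp only [hlam'def]
    rw [show (σ * lam j) ^ 2 * s' = lam j ^ 2 * (σ ^ 2 * s') by ring,
      show (σ * lam j) • y' = lam j • σ • y' by rw [smul_smul, mul_comm],
      mul_smul, h, smul_smul, smul_smul,
      show σ * (R * (lam j / 2) / ν) = R * (σ * lam j / 2) / ν by ring,
      show T + (R * (lam j / 2)) ^ 2 * (σ ^ 2 * s') / ν = T + (R * (σ * lam j / 2)) ^ 2 * s' / ν by ring,
      show R * (lam j / 2) * σ = R * (σ * lam j / 2) by ring]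
  · -- (L3') local `L³` convergence of the rescaled zooms to `w'`
    have hus : ∀ f g : ℝ → (EuclideanSpace ℝ (Fin 3)) → (EuclideanSpace ℝ (Fin 3)),
        uncurry (f - g) = uncurry f - uncurry g := fun f g => rfl
    intro a ha
    show Tendsto (fun j => eLpNorm
      (uncurry ((lam' j) • stPull ((lam' j) ^ 2) (lam' j) (0 : ℝ) (0 : (EuclideanSpace ℝ (Fin 3))) v') - uncurry w') 3
      (volume.restrict (parabolicCylinder a (0 : ℝ × (EuclideanSpace ℝ (Fin 3)))))) atTop (𝓝 0)
    have hdiff : ∀ j, uncurry ((lam' j) • stPull ((lam' j) ^ 2) (lam' j) (0 : ℝ) (0 : (EuclideanSpace ℝ (Fin 3))) v') -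
        uncurry w' = uncurry (σ • stPull (σ ^ 2) σ (0 : ℝ) (0 : (EuclideanSpace ℝ (Fin 3)))
          ((lam j) • stPull ((lam j) ^ 2) (lam j) (0 : ℝ) (0 : (EuclideanSpace ℝ (Fin 3))) v' - w)) := by
      intro j
      rw [hZZ j]
      funext z
      obtain ⟨s', y'⟩ := z
      simp only [hw'def, uncurry_apply_pair, Pi.sub_apply, smul_stPull_apply, smul_sub]
    have hconst : (‖σ‖ₑ * (ENNReal.ofReal ((σ ^ 2 * σ ^ 3)⁻¹)) ^ (1 / (3 : ℝ≥0∞).toReal)) ≠ ⊤ :=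
      ENNReal.mul_ne_top enorm_ne_top
        (ENNReal.rpow_ne_top_of_nonneg (one_div_nonneg.2 ENNReal.toReal_nonneg) ENNReal.ofReal_ne_top)
    have key := ENNReal.Tendsto.const_mul (hL3 (a * σ) (mul_pos ha hσ)) (Or.inr hconst)
    rw [mul_zero] at key
    refine key.congr fun j => ?_
    rw [hdiff j]
    conv_rhs => rw [show a = a * σ / σ by field_simp]
    rw [eLpNorm_uncurry_zoom hσ σ _ (a * σ) three_ne_zero ENNReal.ofNat_ne_top, hus]
  · -- (ae') the rescaled limit agrees a.e. with the rescaled profile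
    have hslab : stAffine (σ ^ 2) σ (0 : ℝ) (0 : (EuclideanSpace ℝ (Fin 3))) ⁻¹'
        (Iio (0 : ℝ) ×ˢ (univ : Set (EuclideanSpace ℝ (Fin 3)))) =
        Iio (0 : ℝ) ×ˢ (univ : Set (EuclideanSpace ℝ (Fin 3))) := by
      ext z
      simp only [mem_preimage, mem_prod, mem_Iio, mem_univ, and_true, stAffine_fst, zero_add]
      exact ⟨fun h => neg_of_mul_neg_right h (pow_pos hσ 2).le,
        fun h => mul_neg_of_pos_of_neg (pow_pos hσ 2) h⟩
    have h := ae_eq_restrict_comp_stAffine (f := uncurry w) (g := uncurry v₁) (pow_pos hσ 2) hσ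
      (0 : ℝ) (0 : (EuclideanSpace ℝ (Fin 3))) hae
    rw [hslab] at h
    filter_upwards [h] with z hz
    show σ • uncurry w (stAffine (σ ^ 2) σ (0 : ℝ) (0 : (EuclideanSpace ℝ (Fin 3))) z) =
      σ • uncurry v₁ (stAffine (σ ^ 2) σ (0 : ℝ) (0 : (EuclideanSpace ℝ (Fin 3))) z)
    rw [show uncurry w (stAffine (σ ^ 2) σ (0 : ℝ) (0 : (EuclideanSpace ℝ (Fin 3))) z) =
      uncurry v₁ (stAffine (σ ^ 2) σ (0 : ℝ) (0 : (EuclideanSpace ℝ (Fin 3))) z) from hz]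

set_option maxHeartbeats 400000 in
/-- **LOCAL POINT ZOOM LIMIT WITH VELOCITY AND RIESZ-PRESSURE SLICES**: at a point where a classical Leray–Hopf flow from
rapidly decaying data is locally SPACE–TIME Type I but not backward bounded, some zoom sequence `λⱼ → 0⁺` of
unit-viscosity rescalings converges to a door-class profile `v` (Type-I time rate `C`, space–time decay `D`, continuous,
Oseen-mild, divergence-free) with backward-singular apex, and at EVERY `s < 0`, `y`, BOTH the rescaled velocities
`(λⱼ/ν) u(T + λⱼ²s/ν, x₀ + λⱼy) → v(s,y)` AND the Riesz pressures of the rescaled slices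
`Q[(λⱼ/ν) u(T + λⱼ²s/ν, x₀ + λⱼ ·)](y) → Q[v(s)](y)` — along ONE common sequence. -/
theorem localPointZoomPressureSlices :
    ∀ (ν T : ℝ), 0 < ν → 0 < T → ∀ (u : ℝ → EuclideanSpace ℝ (Fin 3) → EuclideanSpace ℝ (Fin 3))
      (p : ℝ → EuclideanSpace ℝ (Fin 3) → ℝ),
    Literature.Analysis.FluidPDE.IsClassicalNSSolutionOn (Set.Ico 0 T) ν 0 u p →
    Literature.Analysis.FluidPDE.IsLerayHopfOn T ν 0 (u 0) u →
    Literature.Analysis.FluidPDE.HasRapidSpatialDecay (u 0) →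
    ∀ (x₀ : EuclideanSpace ℝ (Fin 3)) (ρ M : ℝ), 0 < ρ →
    (∀ t ∈ Set.Ico 0 T, T - ρ ^ 2 < t → ∀ x ∈ Metric.ball x₀ ρ,
      ‖u t x‖ * (‖x - x₀‖ + Real.sqrt (ν * (T - t))) ≤ M) →
    ¬ Literature.Analysis.FluidPDE.IsBackwardBoundedAt u T x₀ →
    ∃ (C D : ℝ) (v : ℝ → EuclideanSpace ℝ (Fin 3) → EuclideanSpace ℝ (Fin 3)) (lam : ℕ → ℝ),
      (∀ j, 0 < lam j) ∧ Filter.Tendsto lam Filter.atTop (nhds 0) ∧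
      Literature.Analysis.FluidPDE.HasTypeITimeDecay C v ∧ Literature.Analysis.FluidPDE.HasTypeIDecay D v ∧
      ContinuousOn (Function.uncurry v) (Set.Iio (0 : ℝ) ×ˢ Set.univ) ∧
      (∀ s t : ℝ, s < t → t < 0 → ∀ x, v t x =
        Literature.Analysis.UnboundedOperators.heatExtension (v s) (t - s) x -
          Literature.Analysis.FluidPDE.oseenDuhamel 1 s v v t x) ∧
      (∀ t < 0, Literature.Analysis.FluidPDE.VectorCalculus.IsDivFree (v t)) ∧
      Literature.Analysis.FluidPDE.IsBackwardSingularPoint v 0 ∧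
      ∀ s < 0, ∀ y,
        Filter.Tendsto (fun j => (lam j / ν) • u (T + lam j ^ 2 * s / ν) (x₀ + lam j • y)) Filter.atTop
          (nhds (v s y)) ∧
        Filter.Tendsto (fun j => Literature.Analysis.FluidPDE.pressurePotential
          (fun η => (lam j / ν) • u (T + lam j ^ 2 * s / ν) (x₀ + lam j • η)) y) Filter.atTop
          (nhds (Literature.Analysis.FluidPDE.pressurePotential (v s) y)) := by
  intro ν T hν hT u p hsol hLH _ x₀ ρ M hρ hMst hnotbd
  have hM := timeTypeI_of_spaceTimeTypeI hMst
  have hcont : ContinuousOn (uncurry u) (Ico 0 T ×ˢ univ) := hsol.smooth_velocity.continuousOn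
  obtain ⟨R, C₁, v', π', lam, w, v₁, Ks, r₁, hR, hlam, hlam0, hball1, hr₁, hr₁1, hKs, hL3, hae, hP,
    hsing₁, hpt⟩ := localTreeZoomFrame hν hT hsol hLH hρ hM hnotbd
  have hΛpos : ∀ j, 0 < R * (lam j / 2) := fun j => mul_pos hR (half_pos (hlam j))
  have hΛ0 : Tendsto (fun j => R * (lam j / 2)) atTop (𝓝 0) := by simpa using (hlam0.div_const 2).const_mul R
  -- ## common bookkeeping at a slice `s < 0`: `σ = √(−s)`
  have book : ∀ s < 0, 0 < Real.sqrt (-s) ∧ Real.sqrt (-s) ^ 2 = -s ∧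
      (∀ j, T + (R * (Real.sqrt (-s) * lam j / 2)) ^ 2 * (-1) / ν = T + (R * (lam j / 2)) ^ 2 * s / ν) ∧
      (∀ j, R * (Real.sqrt (-s) * lam j / 2) * (Real.sqrt (-s))⁻¹ = R * (lam j / 2)) := by
    intro s hs
    have hns : 0 < -s := neg_pos.2 hs
    have hσ : 0 < Real.sqrt (-s) := Real.sqrt_pos.2 hns
    have hσ2 : Real.sqrt (-s) ^ 2 = -s := Real.sq_sqrt hns.le
    refine ⟨hσ, hσ2, fun j => ?_, fun j => ?_⟩
    · have hs' : s = -Real.sqrt (-s) ^ 2 := by rw [hσ2]; ring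
      conv_rhs => rw [hs']
      ring
    · calc R * (Real.sqrt (-s) * lam j / 2) * (Real.sqrt (-s))⁻¹
          = R * (lam j / 2) * (Real.sqrt (-s) * (Real.sqrt (-s))⁻¹) := by ring
        _ = R * (lam j / 2) := by rw [mul_inv_cancel₀ hσ.ne', mul_one]
  -- ## (i) VELOCITIES at every `s < 0`, `y` (as in `localPointZoomVelGradSlices`)
  have hvel : ∀ s < 0, ∀ y : EuclideanSpace ℝ (Fin 3),
      Tendsto (fun j => ((R * (lam j / 2)) / ν) • u (T + (R * (lam j / 2)) ^ 2 * s / ν)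
        (x₀ + (R * (lam j / 2)) • y)) atTop (𝓝 (v₁ s y)) := by
    intro s hs y
    obtain ⟨hσ, hσ2, e2, e3⟩ := book s hs
    set σ : ℝ := Real.sqrt (-s) with hσdef
    have hσne : σ ≠ 0 := hσ.ne'
    obtain ⟨hlam', hlam0', hpt', hL3', hae'⟩ := frame_rescale hlam hlam0 hpt hL3 hae hσ
    have hcont' : ContinuousOn (uncurry (σ • stPull (σ ^ 2) σ (0 : ℝ) (0 : EuclideanSpace ℝ (Fin 3)) v₁))
        (Iio (0 : ℝ) ×ˢ univ) := cont_smul_stPull hP.2.1 hσ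
    have key := localZoomFrame_tendsto hν hT hcont hρ hM hR hball1 hlam' hlam0' hr₁ hr₁1 hKs hpt' hL3' hae' hcont'
      (σ⁻¹ • y)
    have hZ : ∀ j, ((σ * lam j) • stPull ((σ * lam j) ^ 2) (σ * lam j) (0 : ℝ) (0 : (EuclideanSpace ℝ (Fin 3))) v')
        (-1) (σ⁻¹ • y) = σ • (((R * (lam j / 2)) / ν) • u (T + (R * (lam j / 2)) ^ 2 * s / ν)
          (x₀ + (R * (lam j / 2)) • y)) := by
      intro j
      rw [hpt' j (-1) (σ⁻¹ • y)]
      simp only [smul_smul]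
      have e4 : R * (σ * lam j / 2) / ν = σ * (R * (lam j / 2) / ν) := by ring
      rw [e2 j, e3 j, e4]
    have hlimit : (σ • stPull (σ ^ 2) σ (0 : ℝ) (0 : EuclideanSpace ℝ (Fin 3)) v₁) (-1) (σ⁻¹ • y) = σ • v₁ s y := by
      simp only [smul_stPull_apply, smul_smul, mul_inv_cancel₀ hσne, one_smul, zero_add]
      rw [show σ ^ 2 * (-1) = s by rw [hσ2]; ring]
    have key' : Tendsto (fun j => σ • (((R * (lam j / 2)) / ν) •
        u (T + (R * (lam j / 2)) ^ 2 * s / ν) (x₀ + (R * (lam j / 2)) • y))) atTop (𝓝 (σ • v₁ s y)) := by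
      rw [← hlimit]
      exact Tendsto.congr hZ key
    have key3 := key'.const_smul σ⁻¹
    simp only [smul_smul, inv_mul_cancel_left₀ hσne, inv_mul_cancel₀ hσne, one_smul] at key3
    exact key3
  -- ## the space–time decay of the profile
  have hdecay : HasTypeIDecay (M / ν) v₁ := hasTypeIDecay_of_zoom hν hT hρ hΛpos hΛ0 hMst hvel
  refine ⟨C₁, M / ν, v₁, fun j => R * (lam j / 2), hΛpos, hΛ0, hP.1, hdecay, hP.2.1, hP.2.2.1, hP.2.2.2, hsing₁,
    fun s hs y => ⟨hvel s hs y, ?_⟩⟩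
  -- ## (ii) PRESSURES at `s < 0`, `y`: the frame lemma at time `−1` of the `σ`-rescaled frame
  obtain ⟨hσ, hσ2, e2, e3⟩ := book s hs
  set σ : ℝ := Real.sqrt (-s) with hσdef
  have hσne : σ ≠ 0 := hσ.ne'
  obtain ⟨hlam', hlam0', hpt', hL3', hae'⟩ := frame_rescale hlam hlam0 hpt hL3 hae hσ
  have hrate' : HasTypeITimeDecay C₁ (σ • stPull (σ ^ 2) σ (0 : ℝ) (0 : EuclideanSpace ℝ (Fin 3)) v₁) :=
    rate_smul_stPull hP.1 hσ
  have hcont' : ContinuousOn (uncurry (σ • stPull (σ ^ 2) σ (0 : ℝ) (0 : EuclideanSpace ℝ (Fin 3)) v₁))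
      (Iio (0 : ℝ) ×ˢ univ) := cont_smul_stPull hP.2.1 hσ
  have hmild' := mild_smul_stPull hP.2.2.1 hσ
  -- the rescaled profile slice at `−1` is `σ • v₁(s, σ ·)`, in the decay class with constant `M/ν`
  have hslice : (σ • stPull (σ ^ 2) σ (0 : ℝ) (0 : EuclideanSpace ℝ (Fin 3)) v₁) (-1) = fun η => σ • v₁ s (σ • η) := by
    funext η
    simp only [smul_stPull_apply, zero_add]
    rw [show σ ^ 2 * (-1) = s by rw [hσ2]; ring]
  have hv₁dec : ∀ η : EuclideanSpace ℝ (Fin 3),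
      ‖(σ • stPull (σ ^ 2) σ (0 : ℝ) (0 : EuclideanSpace ℝ (Fin 3)) v₁) (-1) η‖ ≤ (M / ν) / (1 + ‖η‖) := by
    intro η
    rw [hslice]
    dsimp only
    rw [norm_smul, Real.norm_of_nonneg hσ.le]
    have h := hdecay s hs (σ • η)
    rw [norm_smul, Real.norm_of_nonneg hσ.le] at h
    have hden : 0 < σ * ‖η‖ + Real.sqrt (-s) := add_pos_of_nonneg_of_pos (by positivity) hσ
    calc σ * ‖v₁ s (σ • η)‖ ≤ σ * (M / ν / (σ * ‖η‖ + Real.sqrt (-s))) := mul_le_mul_of_nonneg_left h hσ.le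
      _ = M / ν / (1 + ‖η‖) := by
          rw [← hσdef]
          field_simp
          ring
  have key := localZoomFrame_pressure_tendsto hν hT hsol hLH hρ hMst hR hball1 hlam' hlam0' hr₁ hr₁1 hKs hpt'
    hL3' hae' hrate' hcont' hmild' hv₁dec (σ⁻¹ • y)
  -- the physical slices `Wⱼ = (Λⱼ/ν) • u(tⱼ, x₀ + Λⱼ ·)` and their regularity / energy
  set W : ℕ → EuclideanSpace ℝ (Fin 3) → EuclideanSpace ℝ (Fin 3) :=
    fun j η => ((R * (lam j / 2)) / ν) • u (T + (R * (lam j / 2)) ^ 2 * s / ν) (x₀ + (R * (lam j / 2)) • η) with hWdef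
  have htjT : Tendsto (fun j => T + (R * (lam j / 2)) ^ 2 * s / ν) atTop (𝓝 T) := by
    have h : Tendsto (fun j => T + (R * (lam j / 2)) ^ 2 * s / ν) atTop (𝓝 (T + 0 ^ 2 * s / ν)) :=
      tendsto_const_nhds.add (((hΛ0.pow 2).mul_const s).div_const ν)
    have e : T + (0 : ℝ) ^ 2 * s / ν = T := by ring
    rw [e] at h
    exact h
  have htj_lt : ∀ j, T + (R * (lam j / 2)) ^ 2 * s / ν < T := fun j => by
    have : (R * (lam j / 2)) ^ 2 * s / ν < 0 :=
      div_neg_of_neg_of_pos (mul_neg_of_pos_of_neg (pow_pos (hΛpos j) 2) hs) hν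
    linarith
  have hev_t : ∀ᶠ j in atTop, T + (R * (lam j / 2)) ^ 2 * s / ν ∈ Ico 0 T :=
    (htjT.eventually (lt_mem_nhds hT)).mono fun j hj => ⟨hj.le, htj_lt j⟩
  have hWreg : ∀ᶠ j in atTop, ContDiff ℝ 2 (W j) ∧ Integrable fun η => ‖W j η‖ ^ 2 := by
    filter_upwards [hev_t] with j hj
    have hΛj := hΛpos j
    refine ⟨(((hsol.contDiff_velocity hj).of_le (by norm_cast)).comp
      (contDiff_const.add (contDiff_id.const_smul _))).const_smul _, ?_⟩
    have hbase : Integrable (fun x => ‖u (T + (R * (lam j / 2)) ^ 2 * s / ν) x‖ ^ 2) :=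
      (hLH.memLp _ ⟨hj.1, hj.2.le⟩).integrable_norm_pow two_ne_zero
    have hgs : Integrable (fun η : EuclideanSpace ℝ (Fin 3) =>
        ‖u (T + (R * (lam j / 2)) ^ 2 * s / ν) (x₀ + (R * (lam j / 2)) • η)‖ ^ 2) :=
      (hbase.comp_add_left x₀).comp_smul hΛj.ne'
    have hfun : (fun η => ‖W j η‖ ^ 2) = fun η => ((R * (lam j / 2)) / ν) ^ 2 *
        ‖u (T + (R * (lam j / 2)) ^ 2 * s / ν) (x₀ + (R * (lam j / 2)) • η)‖ ^ 2 := by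
      funext η
      simp only [hWdef]
      rw [norm_smul, Real.norm_of_nonneg (div_pos hΛj hν).le, mul_pow]
    rw [hfun]
    exact hgs.const_mul _
  -- the rescaled zoom slice at `−1` is `σ • Wⱼ(σ ·)`
  have hZslice : ∀ j, ((σ * lam j) • stPull ((σ * lam j) ^ 2) (σ * lam j) (0 : ℝ) (0 : EuclideanSpace ℝ (Fin 3)) v')
      (-1) = fun η => σ • W j (σ • η) := by
    intro j
    funext η
    rw [hpt' j (-1) η]
    simp only [hWdef, smul_smul]
    have e4 : R * (σ * lam j / 2) / ν = σ * (R * (lam j / 2) / ν) := by ring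
    rw [e2 j, e4, show R * (σ * lam j / 2) = R * (lam j / 2) * σ by ring]
  -- dilation covariance on both sides
  have hy : σ • σ⁻¹ • y = y := by rw [smul_smul, mul_inv_cancel₀ hσne, one_smul]
  have hlhs : ∀ᶠ j in atTop, pressurePotential (((σ * lam j) • stPull ((σ * lam j) ^ 2) (σ * lam j) (0 : ℝ)
      (0 : EuclideanSpace ℝ (Fin 3)) v') (-1)) (σ⁻¹ • y) = σ ^ 2 * pressurePotential (W j) y := by
    filter_upwards [hWreg] with j hj
    rw [hZslice j, pressurePotential_zoom_of_integrable hj.1 hj.2 σ hσ (σ⁻¹ • y), hy]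
  have hv₁C2 : ContDiff ℝ 2 (v₁ s) := (analyticOnNhd_slice hP.2.1 (bdd_of_hasTypeITimeDecay hP.1) hP.2.2.1 hs).contDiff
  have hrhs : pressurePotential ((σ • stPull (σ ^ 2) σ (0 : ℝ) (0 : EuclideanSpace ℝ (Fin 3)) v₁) (-1)) (σ⁻¹ • y) =
      σ ^ 2 * pressurePotential (v₁ s) y := by
    rw [hslice, pressurePotential_zoom hv₁C2 (decay_slice_of_hasTypeIDecay hdecay hs) σ hσ (σ⁻¹ • y), hy]
  rw [hrhs] at key
  have key' : Tendsto (fun j => σ ^ 2 * pressurePotential (W j) y) atTop (𝓝 (σ ^ 2 * pressurePotential (v₁ s) y)) :=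
    key.congr' hlhs
  have hσ2ne : σ ^ 2 ≠ 0 := pow_ne_zero 2 hσne
  have key3 := key'.const_mul (σ ^ 2)⁻¹
  simp only [← mul_assoc, inv_mul_cancel₀ hσ2ne, one_mul] at key3
  exact key3

/-- **Crux K1 `LocalPointZoomSimilarityPressure` of route `LocalPressureProfileDoor`** (stmt-NavierStokesRegularity-20181),
by name: `localPointZoomPressureSlices` read at the similarity position `√(−t) y`, with the affine covariance
`Q[(λ/ν) u(t, x₀ + λ ·)](z) = (λ/ν)² Q[u(t)](x₀ + λ z)` and `ν⁻¹(T − tⱼ) = (−t)(λⱼ/ν)²`, `√(T − tⱼ)√ν = λⱼ√(−t)`. -/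
theorem LocalPointZoomSimilarityPressure_proof :
    Summit.NavierStokesRegularity.NavierStokesRegularity.Theses.LocalPressureProfileDoor.LocalPointZoomSimilarityPressure := by
  intro ν T hν hT u p hsol hLH hdec x₀ ρ M hρ hMst hnotbd
  obtain ⟨C, D, v, lam, hlam, hlam0, hrate, hdecay, hcont, hmild, hdiv, hsing, hconv⟩ :=
    localPointZoomPressureSlices ν T hν hT u p hsol hLH hdec x₀ ρ M hρ hMst hnotbd
  refine ⟨C, D, v, lam, hlam, hlam0, hrate, hdecay, hcont, hmild, hdiv, hsing, fun t ht y => ?_⟩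
  have hnt : 0 < -t := neg_pos.2 ht
  have hP := (hconv t ht (Real.sqrt (-t) • y)).2
  -- the zoom times lie in `[0, T)` eventually
  have htjT : Tendsto (fun j => T + lam j ^ 2 * t / ν) atTop (𝓝 T) := by
    have h : Tendsto (fun j => T + lam j ^ 2 * t / ν) atTop (𝓝 (T + 0 ^ 2 * t / ν)) :=
      tendsto_const_nhds.add (((hlam0.pow 2).mul_const t).div_const ν)
    have e : T + (0 : ℝ) ^ 2 * t / ν = T := by ring
    rw [e] at h
    exact h
  have htj_lt : ∀ j, T + lam j ^ 2 * t / ν < T := fun j => by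
    have : lam j ^ 2 * t / ν < 0 := div_neg_of_neg_of_pos (mul_neg_of_pos_of_neg (pow_pos (hlam j) 2) ht) hν
    linarith
  have hev_t : ∀ᶠ j in atTop, T + lam j ^ 2 * t / ν ∈ Ico 0 T :=
    (htjT.eventually (lt_mem_nhds hT)).mono fun j hj => ⟨hj.le, htj_lt j⟩
  refine ((hP.const_mul (-t)).congr' ?_)
  filter_upwards [hev_t] with j hj
  have hl := hlam j
  -- regularity and energy of the slice
  have hC2 : ContDiff ℝ 2 (u (T + lam j ^ 2 * t / ν)) := (hsol.contDiff_velocity hj).of_le (by norm_cast)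
  have hL2 : Integrable fun x => ‖u (T + lam j ^ 2 * t / ν) x‖ ^ 2 :=
    (hLH.memLp _ ⟨hj.1, hj.2.le⟩).integrable_norm_pow two_ne_zero
  rw [pressurePotential_smul_comp_affine hC2 hL2 (lam j / ν) hl x₀ (Real.sqrt (-t) • y)]
  -- bookkeeping: `T − tⱼ = λⱼ²(−t)/ν`, `√(T − tⱼ)√ν = λⱼ√(−t)`
  have hdt : T - (T + lam j ^ 2 * t / ν) = lam j ^ 2 * (-t) / ν := by ring
  have hdt0 : 0 ≤ lam j ^ 2 * (-t) / ν := div_nonneg (mul_nonneg (sq_nonneg _) hnt.le) hν.le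
  have hsq : Real.sqrt (lam j ^ 2 * (-t) / ν) * Real.sqrt ν = lam j * Real.sqrt (-t) := by
    rw [← Real.sqrt_mul hdt0 ν, show lam j ^ 2 * (-t) / ν * ν = (lam j * Real.sqrt (-t)) ^ 2 by
      rw [mul_pow, Real.sq_sqrt hnt.le]; field_simp]
    exact Real.sqrt_sq (mul_nonneg hl.le (Real.sqrt_nonneg _))
  rw [hdt]
  simp only [smul_smul]
  rw [hsq]
  ring

end Summit.NavierStokesRegularity.NavierStokesRegularity.Theorems.LocalPressureProfileDoorLocalPointZoomSimilarityPressure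

end
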